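import Literature.Computability.AlgebraicComplexity.KoszulFlatteningGeneralDim
import HarnessLib

/-!
# The reach of Koszul-flattening certificates with `dim A' ≤ 17` arbitrary: at most `R̲ ≥ 17` when two factors have dimension `≤ 9`

Topic `Literature/Computability/AlgebraicComplexity`. Theorems only (no definitions, no named facts).
Companion of `KoszulFlatteningCeiling.lean`, which treats the Landsberg–Ottaviani shape
`A' = K^{2p+1}` (`koszulFlattening p M t`, `p ≤ 8`); this file treats the GENERAL coordinate Koszul
flattening `koszulFlatteningGen q p M.mulVecLin t : Λ^p K^q ⊗ (K^κ)^* → Λ^{p+1} K^q ⊗ K^μ` of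
`KoszulFlatteningGeneralDim.lean` (any `q`, any `p`; Landsberg–Ottaviani 2013 Prop. 4.1.1 / 2015
Thm. 2.1, GCT Prop. 2.4.2.1, CGLV 2022 §3 eq. (8): `rank K_M(t) ≤ C(q−1, p) · R̲(t)`), whose
certificate form in the tree is `le_algBorderRank_of_lt_rank_koszulFlatteningGen`:
`C(q−1,p)·(R−1) < rank K_M(t) ⇒ R ≤ R̲(t)`. This is the shape used after border substitution
(Landsberg–Michałek 2018: kill `m` directions of a `9`-dimensional factor and flatten on the quotient
`A' = K^{9−m}`), and for every restriction/projection `M : K^ι → K^q` whatsoever.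

Landsberg records the dimension-count limit of such determinantal certificates (GCT 2017 §8.2.2: "the
size `r d_{p,q,s} + 1` minors of `T_{p,q,s}` potentially give equations … nontrivial as long as
`r d_{p,q,s} + 1 ≤ min{dim …}`"). The instance proved here: if the two factors that are NOT wedged
have dimension `|κ|, |μ| ≤ 9`, then for every `q ≤ 17` and every `p`

* (`q ≤ 2p+1`, count ROWS) `rank K_M(t) ≤ C(q,p+1)·|μ| ≤ 9·C(q,p+1) ≤ 17·C(q−1,p)`, because
  `(p+1)·C(q,p+1) = q·C(q−1,p)` and `9q ≤ 17(p+1)`;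
* (`q ≥ 2p+2`, count COLUMNS) `rank K_M(t) ≤ C(q,p)·|κ| ≤ 9·C(q,p) ≤ 17·C(q−1,p)`, because
  `(q−p)·C(q,p) = q·C(q−1,p)` and `9q ≤ 17(q−p)`.

Hence **no certificate of the form `le_algBorderRank_of_lt_rank_koszulFlatteningGen` with `q ≤ 17`
can establish `R̲(t) ≥ 18` for a tensor whose second and third factors have dimension `≤ 9`** — in
particular for `⟨3,3,3⟩ ∈ K⁹ ⊗ K⁹ ⊗ K⁹` and for every tensor obtained from it by a linear map on the
first factor (restrictions, border-substitution quotients), whatever the field. (`q ≤ 17` covers every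
`A'` of dimension at most that of `K⁹ ⊕ K⁸`; for `⟨3,3,3⟩` the meaningful range is `q ≤ 9`. The three
factors of `⟨3,3,3⟩` are interchangeable by `algBorderRank_rotate`, so the same holds with any factor
wedged.) The printed window is `17 ≤ R̲(M⟨3⟩) ≤ 20` (CHL 2023 Thm. 1.1, by border apolarity — not a
flattening; Smirnov 2013).

* `nine_mul_choose_succ_le_seventeen_mul_choose` — `9·C(q,p+1) ≤ 17·C(q−1,p)` for `q ≤ 17`, `q ≤ 2p+1`;
* `nine_mul_choose_le_seventeen_mul_choose_of_le` — `9·C(q,p) ≤ 17·C(q−1,p)` for `q ≤ 17`, `2p+2 ≤ q`;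
* `rank_koszulFlatteningGen_le_seventeen_mul_choose` — `rank K_M(t) ≤ 17·C(q−1,p)` (`|κ|,|μ| ≤ 9`, `q ≤ 17`);
* `not_koszulGenCertificate_of_eighteen_le` — for `R ≥ 18` the certificate hypothesis is false;
* `not_koszulGenCertificate_matMulTensor_three_of_eighteen_le` — the instance `t = ⟨3,3,3⟩`.

HONEST FRAMING: a limitation of ONE certificate shape (coordinate Koszul flattening on one factor after
an arbitrary linear map to `K^q`, `q ≤ 17`, bound read through `C(q−1,p)`), proved by counting rows and
columns; it is not a barrier for border apolarity or for non-flattening methods, and not a statement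
about `R̲(⟨3,3,3⟩)` itself. TODO(general form): with `|κ|,|μ| ≤ d` and `q ≤ 2d−1` the same count
gives `rank ≤ (2d−1)·C(q−1,p)`; only `d = 9` is proved here.

## References

* [LandsbergGCT2017] J. M. Landsberg, *Geometry and Complexity Theory*, CUP 2017 — §2.4.2
  (2.4.5)–(2.4.6), Prop. 2.4.2.1 (Koszul flattenings for any `A'`), §8.2.2 (nontriviality range
  `r d + 1 ≤ min{dim}` of Young-flattening minors).
* [LandsbergOttaviani2015] J. M. Landsberg, G. Ottaviani, Theory Comput. 11 (2015) 285–298 — Thm. 2.1 /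
  §2 (the inequality `rank ≤ C(dim A' − 1, p)·R̲`).
* [ConnerGesmundoLandsbergVentura2022] A. Conner, F. Gesmundo, J. M. Landsberg, E. Ventura, comput.
  complexity 31 (2022) — §3 eq. (8).
* [LandsbergMichalek2018] J. M. Landsberg, M. Michałek, IMRN 2018 (15) 4722–4733 — Thm. 1.1 (border
  substitution + Koszul flattening on the quotient).
* [ConnerHarperLandsberg2023] A. Conner, A. Harper, J. M. Landsberg, Forum Math. Pi 11 (2023) e17 —
  Thm. 1.1 (`R̲(M⟨3⟩) ≥ 17`).
-/

namespace Literature.Computability.AlgebraicComplexity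

open Matrix

universe u v₀ v₁ v₂

/-- Row count inequality: `9·C(q,p+1) ≤ 17·C(q−1,p)` for `q ≤ 17` and `q ≤ 2p+1`
(from `(p+1)·C(q,p+1) = q·C(q−1,p)` and `9q ≤ 17(p+1)`).
[cite: LandsbergGCT2017, §8.2.2 (nontriviality range of Young-flattening minors)] -/
theorem nine_mul_choose_succ_le_seventeen_mul_choose {q p : ℕ} (hq : q ≤ 17) (hqp : q ≤ 2 * p + 1) :
    9 * q.choose (p + 1) ≤ 17 * (q - 1).choose p := by
  rcases q with _ | n
  · simp
  · -- `q = n + 1`, `(n+1)·C(n,p) = C(n+1,p+1)·(p+1)`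
    have h1 : (n + 1) * n.choose p = (n + 1).choose (p + 1) * (p + 1) :=
      Nat.add_one_mul_choose_eq n p
    simp only [Nat.add_sub_cancel]
    refine Nat.le_of_mul_le_mul_right ?_ (Nat.succ_pos p)
    calc 9 * (n + 1).choose (p + 1) * (p + 1)
        = 9 * ((n + 1).choose (p + 1) * (p + 1)) := by ring
      _ = 9 * ((n + 1) * n.choose p) := by rw [h1]
      _ = (9 * (n + 1)) * n.choose p := by ring
      _ ≤ (17 * (p + 1)) * n.choose p := Nat.mul_le_mul_right _ (by omega)
      _ = 17 * n.choose p * (p + 1) := by ring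

/-- Column count inequality: `9·C(q,p) ≤ 17·C(q−1,p)` for `q ≤ 17` and `2p+2 ≤ q`
(from `(q−p)·C(q,p) = q·C(q−1,p)` and `9q ≤ 17(q−p)`).
[cite: LandsbergGCT2017, §8.2.2 (nontriviality range of Young-flattening minors)] -/
theorem nine_mul_choose_le_seventeen_mul_choose_of_le {q p : ℕ} (hq : q ≤ 17)
    (hqp : 2 * p + 2 ≤ q) : 9 * q.choose p ≤ 17 * (q - 1).choose p := by
  rcases q with _ | n
  · omega
  · -- `q = n + 1`, `C(n,p)·(n+1) = C(n+1,p)·(n+1−p)`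
    have h1 : n.choose p * (n + 1) = (n + 1).choose p * (n + 1 - p) :=
      Nat.choose_mul_succ_eq n p
    simp only [Nat.add_sub_cancel]
    have hpos : 0 < n + 1 - p := by omega
    refine Nat.le_of_mul_le_mul_right ?_ hpos
    calc 9 * (n + 1).choose p * (n + 1 - p)
        = 9 * ((n + 1).choose p * (n + 1 - p)) := by ring
      _ = 9 * (n.choose p * (n + 1)) := by rw [h1]
      _ = (9 * (n + 1)) * n.choose p := by ring
      _ ≤ (17 * (n + 1 - p)) * n.choose p := Nat.mul_le_mul_right _ (by omega)
      _ = 17 * n.choose p * (n + 1 - p) := by ring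

section Ceiling

variable {K : Type u} [Field K] {ι : Type v₀} {κ : Type v₁} {μ : Type v₂}
variable [Fintype ι] [Fintype κ] [Fintype μ]

/-- **Row/column count**: if the second and third factors have dimension `|κ|, |μ| ≤ 9` and
`q ≤ 17`, every coordinate Koszul flattening `K_M(t) = koszulFlatteningGen q p M t` (a matrix with
`C(q,p+1)·|μ|` rows and `C(q,p)·|κ|` columns) has `rank K_M(t) ≤ 17·C(q−1,p)`, for every `p`.
[cite: LandsbergGCT2017, §8.2.2 (nontriviality range of Young-flattening minors)]
[cite: LandsbergGCT2017, Prop. 2.4.2.1] -/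
theorem rank_koszulFlatteningGen_le_seventeen_mul_choose {q : ℕ} (hq : q ≤ 17)
    (hκ : Fintype.card κ ≤ 9) (hμ : Fintype.card μ ≤ 9) (p : ℕ) (M : Matrix (Fin q) ι K)
    (t : ι → κ → μ → K) :
    (koszulFlatteningGen q p M.mulVecLin t).rank ≤ 17 * (q - 1).choose p := by
  by_cases hqp : q ≤ 2 * p + 1
  · -- count rows
    have hh := Matrix.rank_le_card_height (koszulFlatteningGen q p M.mulVecLin t)
    rw [Fintype.card_prod, card_PSub] at hh
    calc (koszulFlatteningGen q p M.mulVecLin t).rank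
        ≤ q.choose (p + 1) * Fintype.card μ := hh
      _ ≤ q.choose (p + 1) * 9 := Nat.mul_le_mul_left _ hμ
      _ = 9 * q.choose (p + 1) := by ring
      _ ≤ 17 * (q - 1).choose p := nine_mul_choose_succ_le_seventeen_mul_choose hq hqp
  · -- count columns
    have hw := Matrix.rank_le_card_width (koszulFlatteningGen q p M.mulVecLin t)
    rw [Fintype.card_prod, card_PSub] at hw
    calc (koszulFlatteningGen q p M.mulVecLin t).rank
        ≤ q.choose p * Fintype.card κ := hw
      _ ≤ q.choose p * 9 := Nat.mul_le_mul_left _ hκ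
      _ = 9 * q.choose p := by ring
      _ ≤ 17 * (q - 1).choose p :=
          nine_mul_choose_le_seventeen_mul_choose_of_le hq (by omega)

/-- **General Koszul-flattening certificates stop at `17` when the two unwedged factors have
dimension `≤ 9`**: for `R ≥ 18` (and `|κ|, |μ| ≤ 9`, `q ≤ 17`, any `p`) the hypothesis
`C(q−1,p)·(R − 1) < rank K_M(t)` of `le_algBorderRank_of_lt_rank_koszulFlatteningGen` is false,
whatever the field, the map `M : K^ι → K^q` and the tensor `t`.
[cite: LandsbergGCT2017, §8.2.2 (nontriviality range of Young-flattening minors)]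
[cite: LandsbergOttaviani2015, Thm 2.1 and §2] -/
theorem not_koszulGenCertificate_of_eighteen_le {q : ℕ} (hq : q ≤ 17)
    (hκ : Fintype.card κ ≤ 9) (hμ : Fintype.card μ ≤ 9) (p : ℕ) (M : Matrix (Fin q) ι K)
    (t : ι → κ → μ → K) {R : ℕ} (hR : 18 ≤ R) :
    ¬ ((q - 1).choose p * (R - 1) < (koszulFlatteningGen q p M.mulVecLin t).rank) := by
  intro h
  have h17 := rank_koszulFlatteningGen_le_seventeen_mul_choose hq hκ hμ p M t
  have hmono : (q - 1).choose p * 17 ≤ (q - 1).choose p * (R - 1) :=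
    Nat.mul_le_mul_left _ (by omega)
  have := (hmono.trans_lt h).trans_le h17
  rw [Nat.mul_comm] at this
  exact lt_irrefl _ this

end Ceiling

/-- **The instance `⟨3,3,3⟩`** (`κ = μ = Fin 3 × Fin 3`, dimension `9`): no coordinate Koszul
flattening of `matMulTensor K 3 3 3` on the first factor after ANY linear map `M : K^{3×3} → K^q`
with `q ≤ 17` (in particular every restriction to a subspace and every border-substitution quotient
`K^{9−m}`), for any `p` and any field `K`, satisfies the certificate hypothesis for a border-rank bound
`R ≥ 18`; the printed `R̲(M⟨3⟩) ≥ 17` (CHL 2023, Thm. 1.1) is obtained by border apolarity instead.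
[cite: ConnerHarperLandsberg2023, Thm. 1.1]
[cite: LandsbergGCT2017, §8.2.2 (nontriviality range of Young-flattening minors)] -/
theorem not_koszulGenCertificate_matMulTensor_three_of_eighteen_le (K : Type u) [Field K] {q : ℕ}
    (hq : q ≤ 17) (p : ℕ) (M : Matrix (Fin q) (Fin 3 × Fin 3) K) {R : ℕ} (hR : 18 ≤ R) :
    ¬ ((q - 1).choose p * (R - 1) <
        (koszulFlatteningGen q p M.mulVecLin (matMulTensor K 3 3 3)).rank) :=
  not_koszulGenCertificate_of_eighteen_le hq (by simp) (by simp) p M (matMulTensor K 3 3 3) hR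

end Literature.Computability.AlgebraicComplexity
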